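import Summits.NavierStokesRegularity.NavierStokesRegularity.Theses.AxisymmetricExtremality
import Summits.NavierStokesRegularity.NavierStokesRegularity.Theorems.AxisymmetricExtremalityAxisymmetricKatoGlobalReduction
import Summits.NavierStokesRegularity.NavierStokesRegularity.Theorems.AxisymmetricExtremalityAxisymmetricKatoGlobalStubSereginLogSwirlOrigin
import Summits.NavierStokesRegularity.NavierStokesRegularity.Theorems.AxisymmetricExtremalityAxisymmetricKatoGlobalNoSwirlStratum
import Summits.NavierStokesRegularity.NavierStokesRegularity.Theorems.AxisymmetricExtremalityPFoldToAxisymmetric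
import HarnessLib

/-!
# Strategist census companion (family `s`, gen 14) for crux `AxisymmetricKatoGlobal`
# (stmt-NavierStokesRegularity-15453), route `AxisymmetricExtremality`

Typed record of the independent STRATEGY CENSUS `STRATEGY-CENSUS-s19-g14.md`:

* `W0` — the weakest statement `closes` actually consumes from the crux (no axisymmetric minimal
  blow-up datum), with `closes_of_W0` (the route's deciding theorem re-proved from `W0` and the
  PROVED item `PFoldToAxisymmetric`) and `w0_of_crux`;
* `SwirlAxisModulus` — the registered stub `stub_swirlAxisModulus` verbatim, with
  `crux_of_swirlAxisModulus` (over the tree the crux FOLLOWS from the one open a-priori estimate: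
  capstone `Registered.AxisymmetricKatoGlobal_of_logSwirlFacts` + the discharged fact
  `EulerScaling.seregin2022_logSwirl_regularAtOrigin_holds`);
* the best honest typed split found (`SmallSwirlGlobal`, `SwirlReduction`) with its PROVED
  assembly `crux_of_smallSwirl_split` — recorded, NOT registered (piece 1 carries the whole
  analytic obstruction, piece 2 has no mechanism; see the census `## Decomposition`);
* the swirl-free stratum `crux_noSwirl_stratum` (by name, from `NoSwirlStratum`).

0 sorry. Nothing here is a new line; the census verdict is `no-strategy-short-of-summit`.
-/

set_option linter.dupNamespace false

open Set MeasureTheory Filter Topology Function Metric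
open scoped ENNReal NNReal
open Literature.Analysis.FluidPDE Literature.Analysis.FunctionSpaces

namespace Summit.NavierStokesRegularity.NavierStokesRegularity.Cruxes.AxisymmetricKatoGlobal.StrategistS19g14

open Summit.NavierStokesRegularity.NavierStokesRegularity.Theses.AxisymmetricExtremality
open Summit.NavierStokesRegularity.NavierStokesRegularity.Theorems

/-! ## (1) The weakest drop-in intermediate -/

/-- `W0`: for every `ν > 0` there is no axisymmetric minimal blow-up datum. This is exactly what
`closes` consumes from `AxisymmetricKatoGlobal`. -/
def W0 : Prop :=
  ∀ ν : ℝ, 0 < ν → ¬ ∃ (u₀ : EuclideanSpace ℝ (Fin 3) → EuclideanSpace ℝ (Fin 3))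
      (g : HomSobolev (EuclideanSpace ℝ (Fin 3)) (EuclideanSpace ℂ (Fin 3)) (1 / 2 : ℝ)),
      IsMinimalBlowupDatum ν u₀ g ∧ IsAxisymmetric u₀

/-- The crux implies `W0` (minimal blow-up data have no global Kato solution). -/
theorem w0_of_crux : AxisymmetricKatoGlobal → W0 := by
  intro h ν hν ⟨u₀, g, hmin, hax⟩
  obtain ⟨hL3, hrep, hdiv, -, hnot⟩ := hmin
  exact hnot (h ν hν u₀ g hL3 hrep hdiv (fun θ x => hax θ x))

/-- The route's deciding theorem re-proved from `W0` in place of the crux, using the PROVED item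
`PFoldToAxisymmetric` by name: `closes` touches the crux only at an axisymmetric MINIMAL blow-up
datum. -/
theorem closes_of_W0 (h₂ : MinimalDatumPFold) (hW : W0) : NavierStokesRegularity := by
  have h₄ : PFoldToAxisymmetric := axisymmetricExtremality_pFoldToAxisymmetric_proof
  show Literature.NS.NavierStokesExistenceSmoothR3
  intro ν hν u₀ hsm hdiv hdec
  by_contra hno
  obtain ⟨u₁, g, hmin, hax⟩ := h₄ ν hν (h₂ ν hν ⟨u₀, hsm, hdiv, hdec, hno⟩)
  exact hW ν hν ⟨u₁, g, hmin, fun θ x => hax θ x⟩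

/-! ## (2) The crux over the tree = one a-priori estimate (registered stub 3, verbatim) -/

/-- `stub_swirlAxisModulus` of the registered line, verbatim: logarithmic axis modulus of the
swirl `Γ = swirl (u t)` up to the final time of an axisymmetric Kato solution smooth inside. -/
def SwirlAxisModulus : Prop :=
  ∀ ν : ℝ, 0 < ν → ∀ T : ℝ, 0 < T →
    ∀ (u₀ : EuclideanSpace ℝ (Fin 3) → EuclideanSpace ℝ (Fin 3))
      (g : HomSobolev (EuclideanSpace ℝ (Fin 3)) (EuclideanSpace ℂ (Fin 3)) (1 / 2 : ℝ))
      (u : ℝ → EuclideanSpace ℝ (Fin 3) → EuclideanSpace ℝ (Fin 3)),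
      g.Represents (Literature.Analysis.FunctionSpaces.EuclideanSpace.complexify ∘ u₀) →
      IsKatoSolutionOn T ν u₀ u → ContDiffOn ℝ (⊤ : ℕ∞) (uncurry u) (Ioo 0 T ×ˢ univ) →
      (∀ t ∈ Ioo 0 T, IsAxisymmetric (u t)) →
      ∀ t₀ ∈ Ioo 0 T, ∃ C δ₀ : ℝ, 0 < δ₀ ∧ δ₀ < 1 ∧
        ∀ t ∈ Ico t₀ T, ∀ x : EuclideanSpace ℝ (Fin 3), cylRadius x ≤ δ₀ →
          |swirl (u t) x| ≤ C / |Real.log (cylRadius x)| ^ 3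

/-- Over the current tree the crux follows from the single open a-priori estimate
`SwirlAxisModulus` (capstone of the registered line with every other stub discharged). -/
theorem crux_of_swirlAxisModulus : SwirlAxisModulus → AxisymmetricKatoGlobal :=
  AxisymmetricKatoGlobal.Registered.AxisymmetricKatoGlobal_of_logSwirlFacts
    AxisymmetricKatoGlobal.EulerScaling.seregin2022_logSwirl_regularAtOrigin_holds

/-! ## (3) Best honest typed split found: small swirl × swirl reduction (NOT registered) -/

/-- Piece 1 (open; ceiling = log-Hardy loss, Lei–Zhang 2017 Cor. 1.3 needs `|Γ| ≤ C|ln r|⁻²`):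
scale-invariantly SMALL swirl `sup |Γ₀| ≤ ε ν` gives a global Kato solution. -/
def SmallSwirlGlobal : Prop :=
  ∃ ε : ℝ, 0 < ε ∧ ∀ ν : ℝ, 0 < ν →
    ∀ (u₀ : EuclideanSpace ℝ (Fin 3) → EuclideanSpace ℝ (Fin 3))
      (g : HomSobolev (EuclideanSpace ℝ (Fin 3)) (EuclideanSpace ℂ (Fin 3)) (1 / 2 : ℝ)),
      MemLp u₀ 3 volume → g.Represents (Literature.Analysis.FunctionSpaces.EuclideanSpace.complexify ∘ u₀) →
      IsWeaklyDivFree u₀ → IsAxisymmetric u₀ → (∀ x, |swirl u₀ x| ≤ ε * ν) →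
      HasGlobalKatoSolution ν u₀

/-- Piece 2 (open, no mechanism known): blow-up in the axisymmetric Kato class, if it happens at
all, already happens from data with swirl below ANY scale-invariant threshold. -/
def SwirlReduction : Prop :=
  ∀ ε : ℝ, 0 < ε → ∀ ν : ℝ, 0 < ν →
    (∃ (u₀ : EuclideanSpace ℝ (Fin 3) → EuclideanSpace ℝ (Fin 3))
      (g : HomSobolev (EuclideanSpace ℝ (Fin 3)) (EuclideanSpace ℂ (Fin 3)) (1 / 2 : ℝ)),
      MemLp u₀ 3 volume ∧ g.Represents (Literature.Analysis.FunctionSpaces.EuclideanSpace.complexify ∘ u₀) ∧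
      IsWeaklyDivFree u₀ ∧ IsAxisymmetric u₀ ∧ ¬ HasGlobalKatoSolution ν u₀) →
    ∃ (u₀ : EuclideanSpace ℝ (Fin 3) → EuclideanSpace ℝ (Fin 3))
      (g : HomSobolev (EuclideanSpace ℝ (Fin 3)) (EuclideanSpace ℂ (Fin 3)) (1 / 2 : ℝ)),
      MemLp u₀ 3 volume ∧ g.Represents (Literature.Analysis.FunctionSpaces.EuclideanSpace.complexify ∘ u₀) ∧
      IsWeaklyDivFree u₀ ∧ IsAxisymmetric u₀ ∧ (∀ x, |swirl u₀ x| ≤ ε * ν) ∧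
      ¬ HasGlobalKatoSolution ν u₀

/-- The split's assembly, proved (pure logic), concluding the crux BY NAME. -/
theorem crux_of_smallSwirl_split : SmallSwirlGlobal → SwirlReduction → AxisymmetricKatoGlobal := by
  rintro ⟨ε, hε, hsmall⟩ hred ν hν u₀ g hL3 hrep hdiv hax
  by_contra hng
  obtain ⟨u₁, g₁, hL3₁, hrep₁, hdiv₁, hax₁, hsw₁, hng₁⟩ :=
    hred ε hε ν hν ⟨u₀, g, hL3, hrep, hdiv, fun θ x => hax θ x, hng⟩
  exact hng₁ (hsmall ν hν u₁ g₁ hL3₁ hrep₁ hdiv₁ hax₁ hsw₁)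

/-! ## (4) The decided stratum (by name) -/

/-- The swirl-free stratum of the crux is a theorem for every viscosity (`NoSwirlStratum`). -/
theorem crux_noSwirl_stratum :
    ∀ ν : ℝ, 0 < ν → ∀ u₀ : EuclideanSpace ℝ (Fin 3) → EuclideanSpace ℝ (Fin 3),
      MemLp u₀ 3 volume → IsWeaklyDivFree u₀ → IsAxisymmetric u₀ → HasNoSwirl u₀ →
      HasGlobalKatoSolution ν u₀ :=
  fun _ hν _ hu₀ hdiv hax hsw =>
    AxisymmetricKatoGlobal.NoSwirlStratum.hasGlobalKatoSolution_of_isAxisymmetric_hasNoSwirl_viscosity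
      hν hu₀ hdiv hax hsw

end Summit.NavierStokesRegularity.NavierStokesRegularity.Cruxes.AxisymmetricKatoGlobal.StrategistS19g14
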